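import Summits.QuantumAdvantage.QuantumAdvantage.Theorems.CharDialDisjPencilC

/-! # CharDialDisjPencil — part 4/4 (mechanical split for landing of `CharDialDisjPencil`; content verbatim; scopes re-opened with their variables) -/

noncomputable section
open Finset
open Summit.QuantumAdvantage.AdviceFreeQNC0 Summit.QuantumAdvantage.AdviceFreeQNC0.JLinPeel

namespace Summit.QuantumAdvantage.AdviceFreeQNC0.JLinPeel
open AffBells22 AffBells23 Subcube

section PrefixGaps
variable {n : ℕ}

/-- the size of a rank class is the gap length. -/
theorem card_cutRank_eq (S : Finset (Fin (n + 1))) {R : ℕ} (hR : S.card = R) (j : Fin R) :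
    (univ.filter fun i : Fin n => cutRank S i = j.val).card = (S.orderEmbOfFin hR j).val - gapLo S hR j := by
  have hen : (S.orderEmbOfFin hR j).val ≤ n := Nat.lt_succ_iff.1 (S.orderEmbOfFin hR j).isLt
  have hI : ((univ.filter fun i : Fin n => cutRank S i = j.val).map Fin.valEmbedding) =
      Finset.Ico (gapLo S hR j) (S.orderEmbOfFin hR j).val := by
    ext k
    simp only [mem_map, mem_filter, mem_univ, true_and, Fin.valEmbedding_apply, Finset.mem_Ico]
    constructor
    · rintro ⟨i, hi, rfl⟩; exact (cutRank_eq_iff S hR j i).1 hi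
    · rintro ⟨h1, h2⟩; exact ⟨⟨k, by omega⟩, (cutRank_eq_iff S hR j ⟨k, by omega⟩).2 ⟨h1, h2⟩, rfl⟩
  rw [← card_map Fin.valEmbedding, hI, Nat.card_Ico]

/-- **prefix indicators lie in the span of the rank classes**: for `g ∈ S` with `k` cuts of `S` below it,
`𝟙_{[0,g)} = Σ_{j ≤ k} 𝟙{cutRank = j}`. -/
theorem prefix_mem_rankSpan (p : ℕ) (S : Finset (Fin (n + 1))) {R : ℕ} (hR : S.card = R) {g : Fin (n + 1)}
    (hg : g ∈ S) (t : ZMod p) : ∃ l : Fin R → ZMod p,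
      (fun i : Fin n => if i.val < g.val then t else 0) =
        fun i => ∑ j, l j * (if cutRank S i = j.val then (1 : ZMod p) else 0) := by
  classical
  set k := (S.filter (· < g)).card with hk
  refine ⟨fun j => if j.val ≤ k then t else 0, ?_⟩
  funext i
  by_cases hig : i.val < g.val
  · have hsub : S.filter (fun g' => g'.val ≤ i.val) ⊆ S.filter (· < g) := fun g' hg' => by
      rw [mem_filter] at hg' ⊢; exact ⟨hg'.1, Fin.lt_def.2 (lt_of_le_of_lt hg'.2 hig)⟩
    have hrk : cutRank S i ≤ k := card_le_card hsub
    have hkR : k < R := by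
      rw [hk, ← hR]
      exact card_lt_card (Finset.filter_ssubset.2 ⟨g, hg, lt_irrefl g⟩)
    have hiR : cutRank S i < R := lt_of_le_of_lt hrk hkR
    rw [if_pos hig, Finset.sum_eq_single ⟨cutRank S i, hiR⟩ (fun j _ hne => ?_) (fun h => (h (mem_univ _)).elim)]
    · show t = (if cutRank S i ≤ k then t else 0) * (if cutRank S i = cutRank S i then (1 : ZMod p) else 0)
      rw [if_pos hrk, if_pos rfl, mul_one]
    · have hne' : cutRank S i ≠ j.val := fun h' => hne (Fin.ext h'.symm)
      rw [if_neg hne', mul_zero]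
  · have hnotin : g ∉ S.filter (· < g) := fun h' => lt_irrefl g (mem_filter.1 h').2
    have hsub : insert g (S.filter (· < g)) ⊆ S.filter (fun g' => g'.val ≤ i.val) := by
      intro g' hg'
      rw [mem_insert] at hg'
      rw [mem_filter]
      rcases hg' with rfl | hg'
      · exact ⟨hg, by omega⟩
      · rw [mem_filter] at hg'
        exact ⟨hg'.1, by have := Fin.lt_def.1 hg'.2; omega⟩
    have hrk : k < cutRank S i := by
      have h1 := card_le_card hsub
      rw [card_insert_of_notMem hnotin] at h1
      change k + 1 ≤ cutRank S i at h1
      omega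
    rw [if_neg hig]
    refine (Finset.sum_eq_zero fun j _ => ?_).symm
    by_cases hj : cutRank S i = j.val
    · have hjk : ¬ j.val ≤ k := by omega
      simp only [if_neg hjk, zero_mul]
    · simp only [if_neg hj, mul_zero]

end PrefixGaps

section PrefixSep

variable (p : ℕ) [Fact p.Prime] {n : ℕ}

/-- **DISJOINT PENCILS ON SUBCUBES with the support DICHOTOMY** (pruning): as `disjPencil_sub_unif`, but each direction is
either identically zero OFF `W` or has `≥ G` nonzero coefficients off `W` — the zero directions are pruned from the pencil
(they are constant on the subcube and absorbed by the tables). -/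
theorem disjPencil_sub_dich (hp : 5 ≤ p) : ∃ θ : ℝ, θ < 1 ∧ ∃ E n₀ : ℕ, ∀ n ≥ n₀, ∀ (R G : ℕ),
    E * n * (Nat.log 2 n) ^ 5 ≤ G ^ 2 → ∀ (W : Finset (Fin n)) (β : Fin n → Bool) (c : ℕ) (D : JLinData p n),
      2 * W.card ≤ n → (∀ g, (D.J g).card ≤ Nat.log 2 n) →
      (∃ V : Fin R → Fin n → ZMod p,
        (∀ j j', j ≠ j' → ∀ i, V j i = 0 ∨ V j' i = 0) ∧
        (∀ j, (∀ i, i ∉ W → V j i = 0) ∨ G ≤ (univ.filter fun i : Fin n => i ∉ W ∧ V j i ≠ 0).card) ∧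
        ∀ g, ¬ (∀ u s s', D.h g u s = D.h g u s') → ∃ l : Fin R → ZMod p, ∀ i, i ∉ W → D.a g i = ∑ j, l j * V j i) →
      ((univ.filter fun u : Fin n → Bool => ringWinU c D.strat (subcubeMerge W β u) = true).card : ℝ) ≤
        θ * (2 : ℝ) ^ n := by
  obtain ⟨θ, hθ, E, n₀, h⟩ := disjPencil_sub_unif p hp
  refine ⟨θ, hθ, E, n₀, fun n hn R G hE W β c D hW hJ hV => ?_⟩
  classical
  obtain ⟨V, hdisj, hdich, hA⟩ := hV
  -- prune: keep the directions that do not vanish off `W`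
  set T : Finset (Fin R) := univ.filter fun j => ¬ (∀ i, i ∉ W → V j i = 0) with hT
  set m := T.card with hm
  set f := T.orderEmbOfFin hm.symm with hf
  have hfT : ∀ k, f k ∈ T := fun k => Finset.orderEmbOfFin_mem T hm.symm k
  refine h n hn m G hE W β c D hW hJ ⟨fun k => V (f k), fun k k' hne i => hdisj _ _ (fun h' => hne (f.injective h')) i,
    fun k => ?_, fun g hg => ?_⟩
  · rcases hdich (f k) with h0 | h1
    · exact absurd h0 (mem_filter.1 (hfT k)).2
    · exact h1
  · obtain ⟨l, hl⟩ := hA g hg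
    refine ⟨fun k => l (f k), fun i hi => ?_⟩
    rw [hl i hi, ← Finset.sum_filter_add_sum_filter_not univ (fun j => ¬ (∀ i, i ∉ W → V j i = 0))]
    have hzero : ∑ j ∈ univ.filter (fun j => ¬ ¬ (∀ i, i ∉ W → V j i = 0)), l j * V j i = 0 :=
      Finset.sum_eq_zero fun j hj => by
        have hj' : ∀ i, i ∉ W → V j i = 0 := by have := (mem_filter.1 hj).2; push Not at this; exact this
        rw [hj' i hi, mul_zero]
    rw [hzero, add_zero]
    exact sum_enum T hm.symm (fun j => l j * V j i)

/-- **WELL-SEPARATED ADAPTIVE PREFIX COUNTERS LOSE** (every prime `p ≥ 5`, ONE `θ`; a rung of the `PrefixFormHard` face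
ABOVE the cube-root ceiling): `log₂ n`-junta ⊕ PREFIX-FORM data (`a_g = t_g·𝟙_{[0,g)}`) whose non-blind cuts are pairwise
`≥ G` apart and `≥ G` from the start, `E·n·(log₂ n)⁵ ≤ G²` — up to `n/G ≈ √n/polylog` adaptive MOD-`p` prefix counters — win
on at most `θ·2ⁿ` inputs.  Pencil = the rank classes `𝟙{cutRank = j}` (the gaps between consecutive non-blind cuts). -/
theorem prefixSep_hard_unif (hp : 5 ≤ p) : ∃ θ : ℝ, θ < 1 ∧ ∃ E n₀ : ℕ, ∀ n ≥ n₀, ∀ G : ℕ,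
    E * n * (Nat.log 2 n) ^ 5 ≤ G ^ 2 → ∀ (c : ℕ) (D : JLinData p n), (∀ g, (D.J g).card ≤ Nat.log 2 n) →
      (∀ g, ∃ t : ZMod p, D.a g = fun i => if i.val < g.val then t else 0) →
      (∀ g g' : Fin (n + 1), ¬ (∀ u s s', D.h g u s = D.h g u s') → ¬ (∀ u s s', D.h g' u s = D.h g' u s') →
        g < g' → g.val + G ≤ g'.val) →
      (∀ g : Fin (n + 1), ¬ (∀ u s s', D.h g u s = D.h g u s') → G ≤ g.val) →
      (winCount c D.strat : ℝ) ≤ θ * (2 : ℝ) ^ n := by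
  obtain ⟨θ, hθ, E, n₀, h⟩ := disjPencil_hard_unif p hp
  refine ⟨θ, hθ, E, n₀, fun n hn G hE c D hJ hpre hsep hfirst => ?_⟩
  classical
  set S : Finset (Fin (n + 1)) := univ.filter fun g => ¬ (∀ u s s', D.h g u s = D.h g u s') with hSdef
  set R := S.card with hR
  set e : Fin R ↪o Fin (n + 1) := S.orderEmbOfFin hR.symm with he
  have heS : ∀ j, e j ∈ S := fun j => Finset.orderEmbOfFin_mem S hR.symm j
  have henb : ∀ j, ¬ (∀ u s s', D.h (e j) u s = D.h (e j) u s') := fun j => (mem_filter.1 (heS j)).2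
  set V : Fin R → Fin n → ZMod p := fun j i => if cutRank S i = j.val then 1 else 0 with hVdef
  refine h n hn R G hE c D hJ ⟨V, fun j j' hne i => ?_, fun j => ?_, fun g hg => ?_⟩
  · by_cases hij : cutRank S i = j.val
    · right
      have hij' : cutRank S i ≠ j'.val := fun h' => hne (Fin.ext (hij.symm.trans h'))
      simp only [hVdef, if_neg hij']
    · left
      simp only [hVdef, if_neg hij]
  · -- support `≥ G`: the `j`-th gap has length `≥ G`
    have hgap : gapLo S hR.symm j + G ≤ (e j).val := by
      by_cases hj : j.val = 0
      · rw [gapLo, dif_pos hj, zero_add]; exact hfirst _ (henb j)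
      · rw [gapLo, dif_neg hj]
        have hlt : e ⟨j.val - 1, by omega⟩ < e j := e.strictMono (Fin.lt_def.2 (by show j.val - 1 < j.val; omega))
        exact hsep _ _ (henb _) (henb j) hlt
    have hcl : (univ.filter fun i : Fin n => V j i ≠ 0) = univ.filter fun i : Fin n => cutRank S i = j.val := by
      refine filter_congr fun i _ => ?_
      simp only [hVdef]
      constructor
      · intro hv; by_contra hc; exact hv (if_neg hc)
      · intro hc; rw [if_pos hc]; exact one_ne_zero
    rw [hcl, card_cutRank_eq S hR.symm j]
    change G ≤ (e j).val - gapLo S hR.symm j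
    omega
  · obtain ⟨t, ht⟩ := hpre g
    obtain ⟨l, hl⟩ := prefix_mem_rankSpan p S hR.symm (mem_filter.2 ⟨mem_univ _, hg⟩) t
    exact ⟨l, by rw [ht, hl]⟩

/-- **SPARSE ADAPTIVE PREFIX COUNTERS LOSE — ANY PLACEMENT** (every prime `p ≥ 5`, ONE `θ`; the strongest rung of the
`PrefixFormHard` face so far): `log₂ n`-junta ⊕ PREFIX-FORM data with at most `n/(2G)` NON-BLIND cuts, placed anywhere,
`E·n·(log₂ n)⁵ ≤ G²` — i.e. up to `≈ √n/polylog` adaptive MOD-`p` prefix counters at arbitrary times — win on at most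
`θ·2ⁿ` inputs.  Proof: the SHORT gaps (length `< G`) are frozen into `W` (`|W| ≤ R'·G ≤ n/2`), the long gaps form a
disjointly supported pencil of supports `≥ G` off `W`; `disjPencil_sub_dich` on every subcube and fibre counting. -/
theorem prefixSparse_hard_unif (hp : 5 ≤ p) : ∃ θ : ℝ, θ < 1 ∧ ∃ E n₀ : ℕ, ∀ n ≥ n₀, ∀ G : ℕ,
    E * n * (Nat.log 2 n) ^ 5 ≤ G ^ 2 → ∀ (c : ℕ) (D : JLinData p n), (∀ g, (D.J g).card ≤ Nat.log 2 n) →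
      (∀ g, ∃ t : ZMod p, D.a g = fun i => if i.val < g.val then t else 0) →
      2 * G * (univ.filter fun g : Fin (n + 1) => ¬ (∀ u s s', D.h g u s = D.h g u s')).card ≤ n →
      (winCount c D.strat : ℝ) ≤ θ * (2 : ℝ) ^ n := by
  obtain ⟨θ, hθ, E, n₀, h⟩ := disjPencil_sub_dich p hp
  refine ⟨θ, hθ, E, n₀, fun n hn G hE c D hJ hpre hsparse => ?_⟩
  classical
  set S : Finset (Fin (n + 1)) := univ.filter fun g => ¬ (∀ u s s', D.h g u s = D.h g u s') with hSdef
  set R := S.card with hR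
  set e : Fin R ↪o Fin (n + 1) := S.orderEmbOfFin hR.symm with he
  -- the short gaps, frozen
  set short : Fin R → Prop := fun j => (e j).val < gapLo S hR.symm j + G with hshort
  set W : Finset (Fin n) := (univ.filter fun j : Fin R => short j).biUnion
    fun j => univ.filter fun i : Fin n => cutRank S i = j.val with hWdef
  have hWcard : W.card ≤ R * G := by
    calc W.card ≤ ∑ j ∈ univ.filter (fun j : Fin R => short j), (univ.filter fun i : Fin n => cutRank S i = j.val).card :=
          card_biUnion_le
      _ ≤ ∑ j ∈ univ.filter (fun j : Fin R => short j), G := sum_le_sum fun j hj => by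
          rw [card_cutRank_eq S hR.symm j]
          have hsj : (e j).val < gapLo S hR.symm j + G := (mem_filter.1 hj).2
          change (e j).val - gapLo S hR.symm j ≤ G
          omega
      _ ≤ ∑ _j : Fin R, G := sum_le_sum_of_subset_of_nonneg (filter_subset _ _) fun _ _ _ => Nat.zero_le _
      _ = R * G := by rw [sum_const, card_univ, Fintype.card_fin, smul_eq_mul]
  have hW : 2 * W.card ≤ n := by
    calc 2 * W.card ≤ 2 * (R * G) := Nat.mul_le_mul_left _ hWcard
      _ = 2 * G * S.card := by rw [hR]; ring
      _ ≤ n := hsparse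
  set V : Fin R → Fin n → ZMod p := fun j i => if cutRank S i = j.val then 1 else 0 with hVdef
  have hVne : ∀ j i, V j i ≠ 0 ↔ cutRank S i = j.val := fun j i => by
    simp only [hVdef]
    constructor
    · intro hv; by_contra hc; exact hv (if_neg hc)
    · intro hc; rw [if_pos hc]; exact one_ne_zero
  -- every subcube over `W` is hard
  have hfib : ∀ β : Fin n → Bool,
      ((univ.filter fun u : Fin n → Bool => ringWinU c D.strat (subcubeMerge W β u) = true).card : ℝ) ≤ θ * 2 ^ n := by
    intro β
    refine h n hn R G hE W β c D hW hJ ⟨V, fun j j' hne i => ?_, fun j => ?_, fun g hg => ?_⟩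
    · by_cases hij : cutRank S i = j.val
      · right
        have hij' : cutRank S i ≠ j'.val := fun h' => hne (Fin.ext (hij.symm.trans h'))
        simp only [hVdef, if_neg hij']
      · left
        simp only [hVdef, if_neg hij]
    · by_cases hsj : short j
      · -- a short gap lies inside `W`
        left
        intro i hi
        by_contra hv
        have hc := (hVne j i).1 hv
        exact hi (mem_biUnion.2 ⟨j, mem_filter.2 ⟨mem_univ _, hsj⟩, mem_filter.2 ⟨mem_univ _, hc⟩⟩)
      · -- a long gap is disjoint from `W` and has length `≥ G`
        right
        have hcl : (univ.filter fun i : Fin n => i ∉ W ∧ V j i ≠ 0) =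
            univ.filter fun i : Fin n => cutRank S i = j.val := by
          refine filter_congr fun i _ => ?_
          rw [hVne]
          constructor
          · exact fun hh => hh.2
          · intro hc
            refine ⟨fun hiW => ?_, hc⟩
            obtain ⟨j', hj', hi'⟩ := mem_biUnion.1 hiW
            have hjj : j' = j := Fin.ext ((mem_filter.1 hi').2.symm.trans hc)
            exact hsj (hjj ▸ (mem_filter.1 hj').2)
        rw [hcl, card_cutRank_eq S hR.symm j]
        have hl : ¬ (e j).val < gapLo S hR.symm j + G := hsj
        change G ≤ (e j).val - gapLo S hR.symm j
        omega
    · obtain ⟨t, ht⟩ := hpre g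
      obtain ⟨l, hl⟩ := prefix_mem_rankSpan p S hR.symm (mem_filter.2 ⟨mem_univ _, hg⟩) t
      exact ⟨l, fun i _ => by rw [ht, hl]⟩
  -- fibre counting
  have hsum := sum_card_subcube W (fun u : Fin n → Bool => ringWinU c D.strat u = true)
  have h2n : (0 : ℝ) < 2 ^ n := by positivity
  have hmain : (2 : ℝ) ^ n * (winCount c D.strat : ℝ) ≤ 2 ^ n * (θ * 2 ^ n) := by
    have e1 : (2 : ℝ) ^ n * (winCount c D.strat : ℝ) =
        ∑ b : Fin n → Bool, ((univ.filter fun u : Fin n → Bool =>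
          ringWinU c D.strat (subcubeMerge W b u) = true).card : ℝ) := by
      unfold winCount; exact_mod_cast hsum.symm
    rw [e1]
    calc _ ≤ ∑ _b : Fin n → Bool, θ * 2 ^ n := sum_le_sum fun b _ => hfib b
      _ = 2 ^ n * (θ * 2 ^ n) := by rw [sum_const, card_univ, Fintype.card_fun, Fintype.card_bool, Fintype.card_fin, nsmul_eq_mul]; push_cast; ring
  exact le_of_mul_le_mul_left hmain h2n

end PrefixSep

end Summit.QuantumAdvantage.AdviceFreeQNC0.JLinPeel
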